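import Mathlib.Analysis.Matrix.Order
import Summits.Ventures.CertifiedManyBodySolver.Conjectures.OneBodySection

/-!
# Particle–hole symmetry of the one-body window: `E¹_[S](2 − n) = E¹_[S](n)`

HONEST FRAMING: first certified bounds; not a superconductivity verdict; every number certified
or labelled float.  (Venture `CertifiedManyBodySolver`, programme `hubbard-alg`, team M1 seat 4,
structure notes `STRUCTURE-TM1-doped.md`, entries C-M1D-3, T-M1D.25, T-M1D.26 / C-M1D-17; same
setting and notation as `OneBodySection.lean`.)

The feasible set of the translation-invariant one-body window problem on `S` sites,
`{g : g 0 = ν, 0 ⪯ T_S(g) ⪯ 1}`, is mapped onto the feasible set at the complementary density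
`1 − ν` by the staggered particle–hole transform
`g ↦ gᵖʰ`, `gᵖʰ 0 = 1 − g 0`, `gᵖʰ j = −(−1)ʲ g j (j ≥ 1)`:
with the sign matrix `D = diag((−1)ˣ)` one has `D(1 − T_S(g))D = T_S(gᵖʰ)` and
`D T_S(g) D = 1 − T_S(gᵖʰ)`, and congruence preserves `⪰ 0`.  Since `gᵖʰ 1 = g 1`, every bound
`g 1 ≤ b` valid at density `ν` is valid at density `1 − ν` (`hop_bound_ph`): the window values obey
`E¹_[S](2 − n) = E¹_[S](n)`, as the ring values `−(4/L)·sin(πν)/sin(π/L)` do.  In particular every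
exact window certificate of `ToeplitzWindow*.lean` (T-M1D.25, T-M1D.26) and the flat family of
`RingSaturationFlat.lean` transfer verbatim to the complementary fillings, e.g. C-M1D-17 for
`(L, ν) = (8, ⅝), (12, 7/12), (12, ¾), (L, 1 − 1/L)`.
-/

namespace Summit.Ventures.CertifiedManyBodySolver.Conjectures

open Matrix

variable {S : ℕ}

/-- The staggered particle–hole transform of a one-body sequence. -/
def phSeq (g : ℕ → ℝ) : ℕ → ℝ := fun j => if j = 0 then 1 - g 0 else -((-1 : ℝ) ^ j * g j)

/-- Density: `gᵖʰ 0 = 1 − g 0`. -/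
@[simp] theorem phSeq_zero (g : ℕ → ℝ) : phSeq g 0 = 1 - g 0 := by simp [phSeq]

/-- Hopping is invariant: `gᵖʰ 1 = g 1`. -/
@[simp] theorem phSeq_one (g : ℕ → ℝ) : phSeq g 1 = g 1 := by simp [phSeq]

/-- The transform is an involution. -/
theorem phSeq_phSeq (g : ℕ → ℝ) : phSeq (phSeq g) = g := by
  funext j
  by_cases hj : j = 0
  · subst hj; simp [phSeq]
  · simp only [phSeq, hj, if_false]
    rw [show -((-1 : ℝ) ^ j * -((-1 : ℝ) ^ j * g j)) = ((-1 : ℝ) ^ j) ^ 2 * g j by ring]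
    rw [← pow_mul, show j * 2 = 2 * j by ring, pow_mul]
    norm_num

/-- The sign matrix `D = diag((−1)ˣ)`. -/
def stagger (S : ℕ) : Matrix (Fin S) (Fin S) ℝ := Matrix.diagonal fun x => (-1 : ℝ) ^ (x : ℕ)

/-- `D` is real symmetric. -/
theorem stagger_conjTranspose : (stagger S)ᴴ = stagger S := by
  simp [stagger]

/-- Parity bookkeeping: `(−1)ˣ(−1)ʸ = (−1)^{|x − y|}` with `|x − y|` in truncated-subtraction form. -/
theorem neg_one_pow_mul_eq (x y : ℕ) :
    (-1 : ℝ) ^ x * (-1) ^ y = (-1) ^ (x - y + (y - x)) := by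
  rw [← pow_add, neg_one_pow_eq_pow_mod_two (R := ℝ) (x + y),
    neg_one_pow_eq_pow_mod_two (R := ℝ) (x - y + (y - x))]
  congr 1
  omega

/-- `D (1 − T_S(g)) D = T_S(gᵖʰ)`. -/
theorem stagger_one_sub_stagger (g : ℕ → ℝ) :
    stagger S * (1 - toeplitzSection S g) * stagger S = toeplitzSection S (phSeq g) := by
  ext x y
  simp only [stagger, Matrix.mul_diagonal, Matrix.diagonal_mul, Matrix.sub_apply,
    toeplitzSection_apply, phSeq]
  by_cases hxy : x = y
  · subst hxy
    simp only [Nat.sub_self, add_zero, if_true, Matrix.one_apply_eq]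
    rw [show (-1 : ℝ) ^ (x : ℕ) * (1 - g 0) * (-1) ^ (x : ℕ)
        = ((-1 : ℝ) ^ (x : ℕ) * (-1) ^ (x : ℕ)) * (1 - g 0) by ring, ← pow_add,
      ← two_mul, pow_mul]
    norm_num
  · have hne : (x : ℕ) - y + ((y : ℕ) - x) ≠ 0 := by
      intro h
      apply hxy
      ext
      omega
    simp only [Matrix.one_apply_ne hxy, zero_sub, hne, if_false]
    rw [← neg_one_pow_mul_eq]
    ring

/-- `D T_S(g) D = 1 − T_S(gᵖʰ)`. -/
theorem stagger_mul_stagger (g : ℕ → ℝ) :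
    stagger S * toeplitzSection S g * stagger S = 1 - toeplitzSection S (phSeq g) := by
  have h := stagger_one_sub_stagger (S := S) (phSeq g)
  rw [phSeq_phSeq] at h
  -- h : D (1 - T(ph g)) D = T g; conjugate both sides by D (D² = 1)
  have hDD : stagger S * stagger S = 1 := by
    simp only [stagger, Matrix.diagonal_mul_diagonal]
    rw [← Matrix.diagonal_one]
    congr 1
    funext x
    rw [← pow_add, ← two_mul, pow_mul]
    norm_num
  calc stagger S * toeplitzSection S g * stagger S
      = stagger S * (stagger S * (1 - toeplitzSection S (phSeq g)) * stagger S) * stagger S := by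
        rw [h]
    _ = (stagger S * stagger S) * (1 - toeplitzSection S (phSeq g)) * (stagger S * stagger S) := by
        simp only [Matrix.mul_assoc]
    _ = 1 - toeplitzSection S (phSeq g) := by rw [hDD, Matrix.one_mul, Matrix.mul_one]

/-- Feasibility transfers under the particle–hole transform. -/
theorem ph_feasible {g : ℕ → ℝ} (hT : (toeplitzSection S g).PosSemidef)
    (hI : (1 - toeplitzSection S g).PosSemidef) :
    (toeplitzSection S (phSeq g)).PosSemidef ∧ (1 - toeplitzSection S (phSeq g)).PosSemidef := by
  constructor
  · have := hI.conjTranspose_mul_mul_same (stagger S)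
    rwa [stagger_conjTranspose, stagger_one_sub_stagger] at this
  · have := hT.conjTranspose_mul_mul_same (stagger S)
    rwa [stagger_conjTranspose, stagger_mul_stagger] at this

/-- **Particle–hole symmetry of the window bound**: a hopping bound valid for every feasible `g` at
density `ν` holds for every feasible `g` at density `1 − ν` — `E¹_[S](2 − n) = E¹_[S](n)`. -/
theorem hop_bound_ph {ν b : ℝ}
    (h : ∀ g : ℕ → ℝ, g 0 = ν → (toeplitzSection S g).PosSemidef →
      (1 - toeplitzSection S g).PosSemidef → g 1 ≤ b)
    {g : ℕ → ℝ} (h0 : g 0 = 1 - ν) (hT : (toeplitzSection S g).PosSemidef)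
    (hI : (1 - toeplitzSection S g).PosSemidef) : g 1 ≤ b := by
  have hph := ph_feasible hT hI
  have := h (phSeq g) (by rw [phSeq_zero, h0]; ring) hph.1 hph.2
  rwa [phSeq_one] at this

/-- … and attainment transfers too. -/
theorem attained_ph {ν b : ℝ}
    (h : ∃ g : ℕ → ℝ, g 0 = ν ∧ g 1 = b ∧ (toeplitzSection S g).PosSemidef ∧
      (1 - toeplitzSection S g).PosSemidef) :
    ∃ g : ℕ → ℝ, g 0 = 1 - ν ∧ g 1 = b ∧ (toeplitzSection S g).PosSemidef ∧
      (1 - toeplitzSection S g).PosSemidef := by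
  obtain ⟨g, h0, h1, hT, hI⟩ := h
  exact ⟨phSeq g, by rw [phSeq_zero, h0], by rw [phSeq_one, h1], (ph_feasible hT hI).1,
    (ph_feasible hT hI).2⟩

end Summit.Ventures.CertifiedManyBodySolver.Conjectures
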